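import Literature.NumberTheory.Automorphic.SupercuspidalProjective
import Literature.NumberTheory.Automorphic.ParabolicInductionQuotientProofs
import Literature.NumberTheory.Automorphic.IwasawaDecompositionGL
import Literature.NumberTheory.Automorphic.ReductiveGroupData
import Literature.NumberTheory.Automorphic.JacquetModuleProofs
import Mathlib.Analysis.SpecialFunctions.Pow.Complex
import Mathlib.Analysis.SpecialFunctions.Pow.Real
import HarnessLib

/-!
# Projectivity of irreducible supercuspidal representations of `GL_n(F)` (any central character)

Casselman 1995, Thm. 5.4.1 (projectivity half, irreducible case) for `G = GL_n(F)`, `F` a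
non-archimedean local field, **without** the unitarity assumption on the central character:
if `π` is an irreducible admissible supercuspidal representation of `GL_n(F)` with central
character `χ`, `σ` a smooth representation with the same central character and `p : σ → π` a
surjective intertwining map, then `p` has an equivariant section
(`Representation.IsSupercuspidal.exists_intertwiningMap_comp_eq_id_gl`). This is the form in which
projectivity is used in Casselman's Cor. 5.4.3 (no supercuspidal constituent of a properly
induced representation) and in Bernstein–Zelevinsky 1977, 2.4 (b), 2.13 (b), 2.14.

The unitary case (any topological group, any central subgroup `Z₀` modulo which coefficients are
compactly supported) is `Representation.HasCompactCoeffMod.exists_intertwiningMap_comp_eq_id` of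
`SupercuspidalProjective`. The reduction of the general case to it is Casselman's Lemma 5.2.5
("there exists a unique positive real-valued character `χ` of `G` such that the restriction of
`π ⊗ χ` to `Z` is unitary"), carried out here in the most economical form:

* (`Representation.HasCompactCoeffMod.exists_intertwiningMap_comp_eq_id_of_character`, any `G`)
  it suffices to have a *smooth* character `ν : G →* ℂˣ` with `‖χ₀ z‖ = ‖ν z‖` on `Z₀`: twist
  `ω` and `σ` by `ν⁻¹` (irreducibility, admissibility, smoothness, compactness of coefficients
  modulo `Z₀` and intertwining maps are insensitive to twisting by a smooth character;
  `IsAdmissible.twist`, `HasCompactCoeffMod.twist`, `ActsBy.twist`, `IntertwiningMap.twist`,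
  `IntertwiningMap.ofTwist`), apply the unitary case, and untwist the section;
* (`GL_n(F)`) take `Z₀ = ⟨ϖ · 1⟩` for a uniformizer `ϖ`: it is central, and
  `Z(GL_n(F)) = F^× · 1 ⊆ GL_n(𝒪) · Z₀` (`center_subset_glInt_mul_zpowers`, from `u = ϖ^a e`,
  `|e| = 1`), so a supercuspidal `π` has coefficients compact modulo `Z₀`
  (`IsSupercuspidal.hasCompactCoeffMod` with the compact `GL_n(𝒪)`); and take
  `ν = |det|_F^s` (`absDetChar`, with `|·|_F` the normalised absolute value `normAbs` and `s` real),
  a smooth character (trivial on `GL_n(𝒪)`, `isOpen_ker_absDetChar`) whose value at `ϖ · 1` has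
  absolute value `|ϖ|_F^{n s}`, which can be matched with `‖χ(ϖ · 1)‖` by the choice
  `s = log ‖χ(ϖ · 1)‖ / log |det (ϖ · 1)|_F` (when `n = 0` the group is trivial); the norms then
  agree on all of `Z₀ = (ϖ · 1)^ℤ`.

Theorems and four auxiliary definitions (`IntertwiningMap.twist`, `IntertwiningMap.ofTwist`,
`absDet`, `absDetChar`); no named facts, no `sorry`.

## References

* W. Casselman, *Introduction to the theory of admissible representations of `p`-adic reductive
  groups*, unpublished notes (draft 1 May 1995), Lemma 5.2.5, Thm. 5.4.1, Cor. 5.4.3, pp. 48–50.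
  [Casselman1995]
* I. N. Bernstein, A. V. Zelevinsky, *Induced representations of reductive `p`-adic groups I*,
  Ann. Sci. ÉNS (4) 10 (1977), Thm. 2.4 (b), p. 447. [BernsteinZelevinsky1977]
-/

noncomputable section

open scoped Pointwise MatrixGroups
open Function

namespace Representation

open Literature.NumberTheory.Automorphic

/-! ### Twisting by a smooth character -/

section Twist

variable {k G V W : Type*} [Field k] [Group G] [AddCommGroup V] [Module k V]
  [AddCommGroup W] [Module k W] {ρ : Representation k G V} {σ : Representation k G W}

/-- If `ρ` acts on `Z₀` through `χ₀` then `ρ ⊗ ν` acts on `Z₀` through `χ₀ · ν|_{Z₀}`. [folklore] -/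
theorem ActsBy.twist {Z₀ : Subgroup G} {χ₀ : Z₀ →* kˣ} (h : ρ.ActsBy Z₀ χ₀) (ν : G →* kˣ) :
    (ρ.twist ν).ActsBy Z₀ (χ₀ * ν.comp Z₀.subtype) := fun z => by
  refine LinearMap.ext fun v => ?_
  rw [twist_apply, h.apply, smul_smul, LinearMap.smul_apply, LinearMap.id_apply, MonoidHom.mul_apply,
    Units.val_mul, MonoidHom.comp_apply, Subgroup.coe_subtype, mul_comm]

variable (ρ σ) in
/-- An intertwining map `ρ → σ` intertwines the twists `ρ ⊗ ν → σ ⊗ ν` (same linear map).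
[folklore] -/
def IntertwiningMap.twist (p : ρ.IntertwiningMap σ) (ν : G →* kˣ) :
    (ρ.twist ν).IntertwiningMap (σ.twist ν) where
  toLinearMap := p.toLinearMap
  isIntertwining' g := LinearMap.ext fun v => by
    simp only [LinearMap.comp_apply, twist_apply, map_smul, IntertwiningMap.toLinearMap_apply,
      p.isIntertwining]

/-- Unfolding lemma: the twisted intertwining map is the same function. [folklore] -/
@[simp] theorem IntertwiningMap.twist_apply (p : ρ.IntertwiningMap σ) (ν : G →* kˣ) (v : V) :
    IntertwiningMap.twist ρ σ p ν v = p v := rfl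

variable (ρ σ) in
/-- An intertwining map between twists `ρ ⊗ ν → σ ⊗ ν` intertwines `ρ → σ` (same linear map:
cancel the unit `ν g`). [folklore] -/
def IntertwiningMap.ofTwist (ν : G →* kˣ) (s : (ρ.twist ν).IntertwiningMap (σ.twist ν)) :
    ρ.IntertwiningMap σ where
  toLinearMap := s.toLinearMap
  isIntertwining' g := LinearMap.ext fun v => by
    have h : s (((ν g : kˣ) : k) • ρ g v) = ((ν g : kˣ) : k) • σ g (s v) :=
      IntertwiningMap.isIntertwining _ _ s g v
    rw [map_smul] at h
    simp only [LinearMap.comp_apply, IntertwiningMap.toLinearMap_apply]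
    exact (smul_right_injective W (Units.ne_zero (ν g))) h

/-- Unfolding lemma: the untwisted intertwining map is the same function. [folklore] -/
@[simp] theorem IntertwiningMap.ofTwist_apply (ν : G →* kˣ)
    (s : (ρ.twist ν).IntertwiningMap (σ.twist ν)) (v : V) :
    IntertwiningMap.ofTwist ρ σ ν s v = s v := rfl

/-- The kernel of the inverse character is the kernel. [folklore] -/
theorem _root_.MonoidHom.ker_inv_eq (ν : G →* kˣ) : (ν⁻¹ : G →* kˣ).ker = ν.ker := by
  ext g
  simp only [MonoidHom.mem_ker, MonoidHom.inv_apply, inv_eq_one]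

variable [TopologicalSpace G]

/-- **Twisting by a smooth character preserves admissibility**: for a compact open `K`,
`(V ⊗ ν)^K ⊆ V^{K ∩ ker ν}`, and `K ∩ ker ν` is again compact open. [folklore] -/
theorem IsAdmissible.twist [IsTopologicalGroup G] (hρ : ρ.IsAdmissible) {ν : G →* kˣ}
    (hν : IsOpen (ν.ker : Set G)) : (ρ.twist ν).IsAdmissible := by
  refine ⟨hρ.isSmooth.twist hν, fun K hKc => ?_⟩
  set K' : Subgroup G := (K : Subgroup G) ⊓ ν.ker with hK'def
  have hK'o : IsOpen (K' : Set G) := K.isOpen.inter hν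
  have hK'c : IsCompact (K' : Set G) :=
    hKc.of_isClosed_subset (Subgroup.isClosed_of_isOpen _ hK'o) fun g hg => hg.1
  haveI := hρ.finite_fixedPoints ⟨K', hK'o⟩ hK'c
  have hle : (ρ.twist ν).fixedPoints K ≤ ρ.fixedPoints K' := fun v hv => by
    rw [mem_fixedPoints] at hv ⊢
    intro g hg
    have h := hv g hg.1
    rwa [twist_apply, (MonoidHom.mem_ker.1 hg.2 : ν g = 1), Units.val_one, one_smul] at h
  haveI : IsNoetherian k (ρ.fixedPoints K') := IsNoetherian.iff_fg.2 inferInstance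
  exact Module.Finite.of_injective (Submodule.inclusion hle) (Submodule.inclusion_injective hle)

/-- Twisting by a smooth character preserves "coefficients compact modulo `Z₀`" (the smooth
linear forms are the same and `c^{ρ ⊗ ν} = ν · c^{ρ}` has the same support). [folklore] -/
theorem HasCompactCoeffMod.twist [SeparatelyContinuousMul G] {Z₀ : Subgroup G}
    (h : ρ.HasCompactCoeffMod Z₀) {ν : G →* kˣ} (hν : IsOpen (ν.ker : Set G)) :
    (ρ.twist ν).HasCompactCoeffMod Z₀ := by
  intro f hf v
  obtain ⟨C, hC, hsupp⟩ := h f (ρ.mem_contragredient_of_twist hν hf) v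
  refine ⟨C, hC, fun g hg => hsupp ?_⟩
  rw [Function.mem_support] at hg ⊢
  rw [matrixCoeff_twist] at hg
  exact right_ne_zero_of_mul hg

end Twist

/-! ### The non-unitary case by twisting (Casselman 1995, Lemma 5.2.5 + Thm. 5.4.1) -/

section Character

variable {G : Type*} [Group G] [TopologicalSpace G] [IsTopologicalGroup G]
  {E : Type*} [AddCommGroup E] [Module ℂ E] {ω : Representation ℂ G E}
  {U : Type*} [AddCommGroup U] [Module ℂ U] {σ : Representation ℂ G U}
  {Z₀ : Subgroup G} {χ₀ : Z₀ →* ℂˣ}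

/-- **Projectivity, non-unitary form.** As
`HasCompactCoeffMod.exists_intertwiningMap_comp_eq_id`, but instead of `|χ₀| = 1` on `Z₀` we
assume a smooth character `ν : G →* ℂˣ` with `‖χ₀ z‖ = ‖ν z‖` for `z ∈ Z₀` (Casselman 1995,
Lemma 5.2.5: twist by a positive character to make the central character unitary). Proof: twist
`ω` and `σ` by `ν⁻¹`, split, untwist. [cite: Casselman1995, Lemma 5.2.5 and Thm. 5.4.1] -/
theorem HasCompactCoeffMod.exists_intertwiningMap_comp_eq_id_of_character
    {K₀ : Subgroup G} (hK₀o : IsOpen (K₀ : Set G)) (hK₀c : IsCompact (K₀ : Set G))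
    [ω.IsIrreducible] (hωa : ω.IsAdmissible) (hωc : ω.HasCompactCoeffMod Z₀)
    (hZ₀ : Z₀ ≤ Subgroup.center G) (hω₀ : ω.ActsBy Z₀ χ₀)
    (ν : G →* ℂˣ) (hν : IsOpen (ν.ker : Set G))
    (hνχ : ∀ z : Z₀, ‖((χ₀ z : ℂˣ) : ℂ)‖ = ‖((ν z : ℂˣ) : ℂ)‖)
    (hσ : σ.IsSmooth) (hσ₀ : σ.ActsBy Z₀ χ₀)
    (p : σ.IntertwiningMap ω) (hp : Function.Surjective p) :
    ∃ s : ω.IntertwiningMap σ, ∀ e, p (s e) = e := by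
  have hν' : IsOpen ((ν⁻¹ : G →* ℂˣ).ker : Set G) := by rwa [MonoidHom.ker_inv_eq]
  haveI := ω.isIrreducible_twist ν⁻¹
  have h5 : ∀ z : Z₀, ‖(((χ₀ * (ν⁻¹ : G →* ℂˣ).comp Z₀.subtype) z : ℂˣ) : ℂ)‖ = 1 := fun z => by
    have hz0 : ‖((ν z : ℂˣ) : ℂ)‖ ≠ 0 := norm_ne_zero_iff.2 (Units.ne_zero _)
    rw [MonoidHom.mul_apply, Units.val_mul, norm_mul, MonoidHom.comp_apply, Subgroup.coe_subtype,
      MonoidHom.inv_apply, Units.val_inv_eq_inv_val, norm_inv, hνχ z, mul_inv_cancel₀ hz0]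
  obtain ⟨s, hs⟩ := HasCompactCoeffMod.exists_intertwiningMap_comp_eq_id hK₀o hK₀c
    (hωa.twist hν') (hωc.twist hν') hZ₀ (hω₀.twist ν⁻¹) h5 (hσ.twist hν') (hσ₀.twist ν⁻¹)
    (IntertwiningMap.twist σ ω p ν⁻¹) hp
  exact ⟨IntertwiningMap.ofTwist ω σ ν⁻¹ s, fun e => hs e⟩

end Character

end Representation

/-! ### `GL_n(F)`: the unramified characters `|det|^s` and the lattice `⟨ϖ · 1⟩` -/

namespace Literature.NumberTheory.Automorphic

open Matrix Representation ValuativeRel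
open Literature.NumberTheory.GaloisRepresentations.IsNonarchimedeanLocalField

section Scalar

variable {F : Type*} [Field F] {n : ℕ}

/-- Scalar matrices are central (a local copy of `ModPDiagramsGL2`'s `scalar_mem_center`, not
imported here). [folklore] -/
private theorem scalar_mem_center_gl (u : Fˣ) :
    Matrix.GeneralLinearGroup.scalar (Fin n) u ∈ Subgroup.center (GL (Fin n) F) := by
  rw [Matrix.GeneralLinearGroup.center_eq_range_scalar]
  exact ⟨u, rfl⟩

end Scalar

section Integral

variable {F : Type*} [Field F] [ValuativeRel F] {n : ℕ}

/-- A scalar matrix `e · 1` with `|e| = 1` lies in `GL_n(𝒪)`. [folklore] -/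
theorem scalar_mem_glInt {e : F} (he : valuation F e = 1) :
    Matrix.GeneralLinearGroup.scalar (Fin n) (Units.mk0 e ((Valuation.ne_zero_iff _).1
      (by rw [he]; exact one_ne_zero))) ∈ glInt n F := by
  have he0 : e ≠ 0 := (Valuation.ne_zero_iff _).1 (by rw [he]; exact one_ne_zero)
  have hmem : ∀ (u : Fˣ), valuation F (u : F) ≤ 1 → ∀ i j : Fin n,
      ((Matrix.GeneralLinearGroup.scalar (Fin n) u : GL (Fin n) F) : Matrix (Fin n) (Fin n) F) i j ∈
        𝒪[F] := by
    intro u hu i j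
    rw [Matrix.GeneralLinearGroup.coe_scalar, Matrix.scalar_apply, Matrix.diagonal_apply]
    split_ifs
    · exact (Valuation.mem_integer_iff _ _).2 hu
    · exact Subring.zero_mem _
  rw [mem_glInt_iff]
  refine ⟨hmem _ (by rw [Units.val_mk0, he]) , fun i j => ?_⟩
  rw [← map_inv]
  refine hmem _ ?_ i j
  rw [Units.val_inv_eq_inv_val, Units.val_mk0, map_inv₀, he, inv_one]

end Integral

section GLn

variable (F : Type*) [Field F] [ValuativeRel F] [TopologicalSpace F] [IsNonarchimedeanLocalField F]
  (n : ℕ)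

/-- `|det g|_F` as a real number (`normAbs`, the normalised absolute value). [folklore] -/
def absDet (g : GL (Fin n) F) : ℝ :=
  ((normAbs F (g : Matrix (Fin n) (Fin n) F).det : NNReal) : ℝ)

variable {F n}

/-- `|det g|_F > 0`. [folklore] -/
theorem absDet_pos (g : GL (Fin n) F) : 0 < absDet F n g := by
  have h : normAbs F (g : Matrix (Fin n) (Fin n) F).det ≠ 0 :=
    fun h0 => (Matrix.GeneralLinearGroup.det_ne_zero g) ((map_eq_zero (normAbs F)).1 h0)
  exact NNReal.coe_pos.2 (pos_iff_ne_zero.2 h)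

/-- `|det (g h)|_F = |det g|_F |det h|_F`. [folklore] -/
theorem absDet_mul (g h : GL (Fin n) F) : absDet F n (g * h) = absDet F n g * absDet F n h := by
  rw [absDet, absDet, absDet, Units.val_mul, Matrix.det_mul, map_mul, NNReal.coe_mul]

/-- `|det 1|_F = 1`. [folklore] -/
theorem absDet_one : absDet F n 1 = 1 := by
  rw [absDet, Units.val_one, Matrix.det_one, map_one, NNReal.coe_one]

/-- `|det g|_F = 1` for `g ∈ GL_n(𝒪)` (`valuation_det_eq_one_of_mem_glInt`,
`DeltaCharBorel.normAbs_eq_one_of_valuation_eq_one`). [folklore] -/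
theorem absDet_eq_one_of_mem_glInt {g : GL (Fin n) F} (hg : g ∈ glInt n F) : absDet F n g = 1 := by
  rw [absDet, DeltaCharBorel.normAbs_eq_one_of_valuation_eq_one
    (valuation_det_eq_one_of_mem_glInt hg),
    NNReal.coe_one]

variable (F n)

/-- The **unramified character** `|det|_F^s : GL_n(F) →* ℂˣ` for a real exponent `s`
(Casselman 1995, Lemma 5.2.5: the positive characters of `G`). [folklore] -/
def absDetChar (s : ℝ) : GL (Fin n) F →* ℂˣ where
  toFun g := Units.mk0 (((absDet F n g : ℝ) : ℂ) ^ (s : ℂ))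
    (fun h => (absDet_pos g).ne' (Complex.ofReal_eq_zero.1 (Complex.cpow_eq_zero_iff _ _ |>.1 h).1))
  map_one' := Units.ext (by rw [Units.val_mk0, absDet_one, Complex.ofReal_one,
    Complex.one_cpow, Units.val_one])
  map_mul' g h := Units.ext (by
    rw [Units.val_mk0, Units.val_mul, Units.val_mk0, Units.val_mk0, absDet_mul, Complex.ofReal_mul]
    exact Complex.mul_cpow_ofReal_nonneg (absDet_pos g).le (absDet_pos h).le _)

variable {F n}

/-- Unfolding lemma for `|det|_F^s`. [folklore] -/
theorem absDetChar_apply (s : ℝ) (g : GL (Fin n) F) :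
    ((absDetChar F n s g : ℂˣ) : ℂ) = ((absDet F n g : ℝ) : ℂ) ^ (s : ℂ) := rfl

/-- `‖|det g|_F^s‖ = |det g|_F ^ s`. [folklore] -/
theorem norm_absDetChar (s : ℝ) (g : GL (Fin n) F) :
    ‖((absDetChar F n s g : ℂˣ) : ℂ)‖ = absDet F n g ^ s := by
  rw [absDetChar_apply, Complex.norm_cpow_eq_rpow_re_of_pos (absDet_pos g), Complex.ofReal_re]

/-- `|det|_F^s` is trivial on `GL_n(𝒪)`. [folklore] -/
theorem absDetChar_eq_one_of_mem_glInt (s : ℝ) {g : GL (Fin n) F} (hg : g ∈ glInt n F) :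
    absDetChar F n s g = 1 := by
  ext
  rw [absDetChar_apply, absDet_eq_one_of_mem_glInt hg, Complex.ofReal_one, Complex.one_cpow,
    Units.val_one]

/-- `|det|_F^s` is a **smooth** character: its kernel contains the open subgroup `GL_n(𝒪)`.
[folklore] -/
theorem isOpen_ker_absDetChar (s : ℝ) : IsOpen ((absDetChar F n s).ker : Set (GL (Fin n) F)) :=
  Subgroup.isOpen_mono (fun _ hg => (MonoidHom.mem_ker).2 (absDetChar_eq_one_of_mem_glInt s hg))
    (isOpen_glInt n F)

/-- **`Z(GL_n(F)) ⊆ GL_n(𝒪) · ⟨ϖ · 1⟩`**: a central element is `u · 1` with `u = ϖ^a e`,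
`|e| = 1`, i.e. `(e · 1) (ϖ · 1)^a`. Hence the lattice `⟨ϖ · 1⟩ ≅ ℤ` is cocompact in the centre.
[folklore] -/
theorem center_subset_glInt_mul_zpowers {ϖ : F} (hϖ : IsUniformizingElement ϖ) :
    (Subgroup.center (GL (Fin n) F) : Set (GL (Fin n) F)) ⊆
      (glInt n F : Set (GL (Fin n) F)) *
        (Subgroup.zpowers (Matrix.GeneralLinearGroup.scalar (Fin n) (Units.mk0 ϖ hϖ.ne_zero)) :
          Set (GL (Fin n) F)) := by
  intro z hz
  rw [SetLike.mem_coe, Matrix.GeneralLinearGroup.center_eq_range_scalar] at hz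
  obtain ⟨u, rfl⟩ := hz
  obtain ⟨a, e, he, hu⟩ := exists_eq_zpow_mul_of_ne_zero hϖ u.ne_zero
  have he0 : e ≠ 0 := (Valuation.ne_zero_iff _).1 (by rw [he]; exact one_ne_zero)
  refine Set.mem_mul.2 ⟨_, scalar_mem_glInt he,
    (Matrix.GeneralLinearGroup.scalar (Fin n) (Units.mk0 ϖ hϖ.ne_zero)) ^ a,
    Subgroup.zpow_mem_zpowers _ a, ?_⟩
  rw [← map_zpow, ← map_mul]
  congr 1
  ext
  rw [Units.val_mul, Units.val_zpow_eq_zpow_val, Units.val_mk0, Units.val_mk0, hu, mul_comm]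

end GLn

end Literature.NumberTheory.Automorphic

/-! ### Projectivity of irreducible supercuspidals of `GL_n(F)` -/

namespace Representation

open Literature.NumberTheory.Automorphic ValuativeRel
open Literature.NumberTheory.GaloisRepresentations.IsNonarchimedeanLocalField

variable {F : Type*} [Field F] [ValuativeRel F] [TopologicalSpace F] [IsNonarchimedeanLocalField F]
  {n : ℕ} {V : Type*} [AddCommGroup V] [Module ℂ V] {π : Representation ℂ (GL (Fin n) F) V}
  {U : Type*} [AddCommGroup U] [Module ℂ U] {σ : Representation ℂ (GL (Fin n) F) U}

/-- **Irreducible supercuspidal representations of `GL_n(F)` are projective among smooth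
representations with the same central character** (Casselman 1995, Thm. 5.4.1 with Lemma 5.2.5;
Bernstein–Zelevinsky 1977, Thm. 2.4 (b)). Let `π` be an irreducible admissible supercuspidal
representation of `GL_n(F)`, `F` a non-archimedean local field, with central character `χ`; let
`σ` be a smooth representation with central character `χ` and `p : σ → π` a surjective
intertwining map. Then there is an intertwining map `s : π → σ` with `p ∘ s = id`. No unitarity
is assumed: with `Z₀ = ⟨ϖ · 1⟩` (central, cocompact in the centre) the coefficients of `π` are
compact modulo `Z₀`, and the unramified character `|det|_F^s` with
`|det(ϖ · 1)|_F^s = ‖χ(ϖ · 1)‖` makes the character of `Z₀` unitary after twisting.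
[cite: Casselman1995, Thm. 5.4.1 and Lemma 5.2.5] -/
theorem IsSupercuspidal.exists_intertwiningMap_comp_eq_id_gl [π.IsIrreducible]
    (hπa : π.IsAdmissible) (hπc : π.IsSupercuspidal)
    {χ : Subgroup.center (GL (Fin n) F) →* ℂˣ} (hπχ : π.HasCentralCharacter χ)
    (hσ : σ.IsSmooth) (hσχ : σ.HasCentralCharacter χ)
    (p : σ.IntertwiningMap π) (hp : Function.Surjective p) :
    ∃ s : π.IntertwiningMap σ, ∀ v, p (s v) = v := by
  classical
  -- a uniformizer and the lattice `Z₀ = ⟨ϖ · 1⟩`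
  obtain ⟨ϖ₀, hϖ₀⟩ := IsDiscreteValuationRing.exists_irreducible 𝒪[F]
  have hϖ : IsUniformizingElement (ϖ₀ : F) :=
    ⟨ϖ₀.2, fun h => hϖ₀.ne_zero (Subtype.ext h),
      by rw [(IsDiscreteValuationRing.irreducible_iff_uniformizer _).mp hϖ₀]⟩
  set z₁ : GL (Fin n) F := Matrix.GeneralLinearGroup.scalar (Fin n) (Units.mk0 (ϖ₀ : F) hϖ.ne_zero)
    with hz₁def
  set Z₀ : Subgroup (GL (Fin n) F) := Subgroup.zpowers z₁ with hZ₀def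
  have hZ₀ : Z₀ ≤ Subgroup.center (GL (Fin n) F) :=
    (Subgroup.zpowers_le (G := GL (Fin n) F)).2 (scalar_mem_center_gl _)
  have hcomp : π.HasCompactCoeffMod Z₀ :=
    hπc.hasCompactCoeffMod (isCompact_glInt n F) (center_subset_glInt_mul_zpowers hϖ)
  set χ₀ : Z₀ →* ℂˣ := χ.comp (Subgroup.inclusion hZ₀) with hχ₀def
  have hπ₀ : π.ActsBy Z₀ χ₀ := hπχ.actsBy hZ₀
  have hσ₀ : σ.ActsBy Z₀ χ₀ := hσχ.actsBy hZ₀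
  -- the exponent `s`
  have hz₁ : z₁ ∈ Z₀ := Subgroup.mem_zpowers z₁
  set c : ℝ := ‖((χ₀ ⟨z₁, hz₁⟩ : ℂˣ) : ℂ)‖ with hcdef
  have hc : 0 < c := norm_pos_iff.2 (Units.ne_zero _)
  set x₁ : ℝ := absDet F n z₁ with hx₁def
  have hx₁ : 0 < x₁ := absDet_pos z₁
  obtain ⟨s, hs⟩ : ∃ s : ℝ, x₁ ^ s = c := by
    by_cases hlog : Real.log x₁ = 0
    · -- then `x₁ = 1`, which forces `n = 0` or ... in any case `z₁` acts trivially in norm: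
      -- `x₁ = |ϖ|^n = 1` gives `n = 0`, the group is trivial and `c = 1`.
      have hx1 : x₁ = 1 := Real.eq_one_of_pos_of_log_eq_zero hx₁ hlog
      have hn : n = 0 := by
        by_contra hn
        have hlt : x₁ < 1 := by
          rw [hx₁def, absDet, hz₁def, Matrix.GeneralLinearGroup.coe_scalar, Units.val_mk0,
            Matrix.scalar_apply, Matrix.det_diagonal, Finset.prod_const, Finset.card_univ,
            Fintype.card_fin, map_pow, NNReal.coe_pow]
          have h1 : ((normAbs F (ϖ₀ : F) : NNReal) : ℝ) < 1 :=
            NNReal.coe_lt_one.2 (normAbs_lt_one_iff.2 hϖ.valuation_lt_one)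
          have h0 : (0 : ℝ) ≤ ((normAbs F (ϖ₀ : F) : NNReal) : ℝ) := NNReal.coe_nonneg _
          exact pow_lt_one₀ h0 h1 hn
        exact absurd hx1 hlt.ne
      subst hn
      have hz1 : z₁ = 1 := Subsingleton.elim _ _
      refine ⟨0, ?_⟩
      rw [Real.rpow_zero, hcdef]
      have : (⟨z₁, hz₁⟩ : Z₀) = 1 := Subtype.ext hz1
      rw [this, map_one, Units.val_one, norm_one]
    · refine ⟨Real.log c / Real.log x₁, ?_⟩
      rw [Real.rpow_def_of_pos hx₁, mul_div_cancel₀ _ hlog, Real.exp_log hc]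
  -- the norms agree on `Z₀`
  have hnorm : ∀ z : Z₀, ‖((χ₀ z : ℂˣ) : ℂ)‖ = ‖((absDetChar F n s z : ℂˣ) : ℂ)‖ := by
    rintro ⟨z, hz⟩
    obtain ⟨k, rfl⟩ := Subgroup.mem_zpowers_iff.1 hz
    have hk : (⟨z₁ ^ k, hz⟩ : Z₀) = (⟨z₁, hz₁⟩ : Z₀) ^ k := Subtype.ext (by simp)
    have hk' : χ₀ ⟨z₁ ^ k, hz⟩ = χ₀ ⟨z₁, hz₁⟩ ^ k := by rw [hk, map_zpow]
    change ‖((χ₀ ⟨z₁ ^ k, hz⟩ : ℂˣ) : ℂ)‖ = ‖((absDetChar F n s (z₁ ^ k) : ℂˣ) : ℂ)‖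
    rw [hk', map_zpow, Units.val_zpow_eq_zpow_val, Units.val_zpow_eq_zpow_val, norm_zpow,
      norm_zpow, norm_absDetChar, ← hx₁def, hs]
  exact HasCompactCoeffMod.exists_intertwiningMap_comp_eq_id_of_character (isOpen_glInt n F)
    (isCompact_glInt n F) hπa hcomp hZ₀ hπ₀ (absDetChar F n s) (isOpen_ker_absDetChar s) hnorm hσ
    hσ₀ p hp

end Representation
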